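import Summits.Ventures.HodgeRepro.T3CornerCharacter

/-!
# The forced fourth corner character keeps its corner (T3.3, N2 is free — Lean where elementary)

Blind re-derivation cell `pub-hodge-repro`, Tier 3, seat `t3-p2` (prover-pub-hodge-repro-t3-p2-g2-0), sub-goal T3.3 of
`route/TIER3.md` (the witness `X` at `n = 3`; §7 «N2 IS FREE»).  Target tree path
`lean/Summits/Ventures/HodgeRepro/T3ForcedFourth.lean`.  Imports: this seat's `T3CornerCharacter` (and through it
night-1's `RouteCReflexModel`, `T3SeesawSigns`, the typer's `FaceReduce` / `CMType`) — Mathlib +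
`Summits/Ventures/HodgeRepro/` only.

## The statement on paper (`proofs/t3-p2/R3R4-INSTANTIATION.md` §4.4bis, merged as TIER3.md §7)

A face is a family of four CM types `T i` of the Galois CM field `E′` (group model `(G, c)`) with `SumTwo`: every
embedding lies in exactly two corners.  At the Weil-class component `s` the two corners containing `s` carry the
characters `μ_{i₁,s}`, `μ_{i₂,s}` with CM types `s • (T i₁)⁻¹`, `s • (T i₂)⁻¹`, the two corners containing `c * s` carry
`μ_{i₃,cs}`, `μ_{i₄,cs}` with CM types `(c * s) • (T i₃)⁻¹`, `(c * s) • (T i₄)⁻¹` (night-1's `liuType`, the seat's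
`T3CornerCharacter`).  The central-character compatibility N2 of the seesaw forces the fourth character to be
`μ_{i₄,cs} := μ_{i₁,s} μ_{i₂,s} μ_{i₃,cs}⁻¹`; infinity types add, so its infinity type is the function
`Φ_{i₁} + Φ_{i₂} − Φ_{i₃}` on the embeddings, and the paper note claims «by the same count as (N1-sig)» that this
function is the indicator of `(c * s) • (T i₄)⁻¹` — so the forced character is again of weight one with the CM type of
the fourth corner, and its Albanese factor is still `A_{T i₄}`.  This file proves exactly that identity on the model:

* `filter_mem_eq_pair` / `filter_not_mem_eq_pair` — on a face the corners containing `s` are exactly `{i₁, i₂}` and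
  those containing `c * s` exactly `{i₃, i₄}` (the face has four corners, two through each embedding);
* `forced_fourth_indicator` — for every embedding `g`:
  `[g ∈ s • (T i₁)⁻¹] + [g ∈ s • (T i₂)⁻¹] − [g ∈ (c * s) • (T i₃)⁻¹] = [g ∈ (c * s) • (T i₄)⁻¹]` (in `ℤ`);
* `even_card_negative_lines` — the number of the four corner lines that are negative at `g` (Liu Def 4.12: the line
  of `(i, x)` is negative at `g` iff `g ∈ x • (T i)⁻¹`) is EVEN — the parity used by the discriminant half of N1
  (`T3FourthLine.lean`: the fourth skew-hermitian line `e₁ e₂ / e₃` is admissible).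

Nothing here says anything about the status of the Hodge conjecture for CM abelian varieties, which is NOT proved.
-/

set_option autoImplicit false

open Finset
open scoped Pointwise

namespace HodgeRepro

namespace T3.ForcedFourth

open HodgeRepro.RouteC (liuType)
open HodgeRepro.T3.CornerCharacter (mem_smul_liuType_iff)

variable {G : Type*} [Group G] [DecidableEq G]
variable {ι : Type*} [Fintype ι] [DecidableEq ι]

omit [Group G] in
/-- A two-element subset of a two-element filter is the filter. -/
theorem filter_eq_pair_of_card_two {p : ι → Prop} [DecidablePred p] {i j : ι} (hij : i ≠ j) (hi : p i) (hj : p j)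
    (hcard : (univ.filter p).card = 2) : univ.filter p = {i, j} := by
  symm
  apply eq_of_subset_of_card_le
  · intro k hk
    rcases mem_insert.1 hk with rfl | hk
    · exact mem_filter.2 ⟨mem_univ _, hi⟩
    · rw [mem_singleton] at hk
      subst hk
      exact mem_filter.2 ⟨mem_univ _, hj⟩
  · rw [hcard, card_pair hij]

omit [Group G] in
/-- On a face the corners containing `s` are exactly the two given ones. -/
theorem filter_mem_eq_pair (T : ι → Finset G) (h2 : SumTwo T) {s : G} {i₁ i₂ : ι} (h12 : i₁ ≠ i₂)
    (hs₁ : s ∈ T i₁) (hs₂ : s ∈ T i₂) : (univ.filter fun i => s ∈ T i) = {i₁, i₂} :=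
  filter_eq_pair_of_card_two h12 hs₁ hs₂ (h2 s)

/-- On a face (four corners) the corners NOT containing `s` — i.e. containing `c * s` — are exactly the two given
ones. -/
theorem filter_not_mem_eq_pair {c : G} (T : ι → Finset G) (hT : ∀ i, IsCMType c (T i)) (h2 : SumTwo T)
    (h4 : Fintype.card ι = 4) {s : G} {i₃ i₄ : ι} (h34 : i₃ ≠ i₄) (hs₃ : c * s ∈ T i₃) (hs₄ : c * s ∈ T i₄) :
    (univ.filter fun i => s ∉ T i) = {i₃, i₄} := by
  have hcard : (univ.filter fun i => s ∉ T i).card = 2 := by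
    have e := card_filter_add_card_filter_not (s := (univ : Finset ι)) (p := fun i => s ∈ T i)
    rw [h2 s, card_univ, h4] at e
    omega
  exact filter_eq_pair_of_card_two h34 ((hT i₃).conj_mem_iff s |>.1 hs₃) ((hT i₄).conj_mem_iff s |>.1 hs₄) hcard

/-- **The forced fourth character keeps its corner.**  For a face `T` (`SumTwo`, four corners, CM types), the
component `s`, the two corners `i₁ ≠ i₂` containing `s` and the two corners `i₃ ≠ i₄` containing `c * s`, and any
embedding `g`:
`[g ∈ s • (T i₁)⁻¹] + [g ∈ s • (T i₂)⁻¹] − [g ∈ (c * s) • (T i₃)⁻¹] = [g ∈ (c * s) • (T i₄)⁻¹]`.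
Read: the infinity type `Φ_{i₁} + Φ_{i₂} − Φ_{i₃}` of `μ_{i₁,s} μ_{i₂,s} μ_{i₃,cs}⁻¹` is the indicator of the CM type
`(c * s) • (T i₄)⁻¹` of the fourth corner (TIER3.md §7, «N2 IS FREE»). -/
theorem forced_fourth_indicator {c : G} (hc : IsComplexConj c) (T : ι → Finset G)
    (hT : ∀ i, IsCMType c (T i)) (h2 : SumTwo T) (h4 : Fintype.card ι = 4) {s : G} {i₁ i₂ i₃ i₄ : ι}
    (h12 : i₁ ≠ i₂) (hs₁ : s ∈ T i₁) (hs₂ : s ∈ T i₂) (h34 : i₃ ≠ i₄) (hs₃ : c * s ∈ T i₃) (hs₄ : c * s ∈ T i₄)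
    (g : G) :
    ((if g ∈ s • liuType (T i₁) then 1 else 0) + (if g ∈ s • liuType (T i₂) then 1 else 0)
        - (if g ∈ (c * s) • liuType (T i₃) then 1 else 0) : ℤ)
      = if g ∈ (c * s) • liuType (T i₄) then 1 else 0 := by
  -- the count of N1's real-place half, with `u := g⁻¹ * s`
  have key := T3.SeesawSigns.sumTwo_card_inter_eq_card_compl_inter T h2 h4 s (g⁻¹ * s)
  rw [filter_mem_eq_pair T h2 h12 hs₁ hs₂, filter_not_mem_eq_pair T hT h2 h4 h34 hs₃ hs₄,
    card_filter, card_filter, sum_pair h12, sum_pair h34] at key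
  -- translate the memberships `g ∈ x • (T i)⁻¹`
  have m : ∀ i, (g ∈ (c * s) • liuType (T i)) ↔ g⁻¹ * s ∉ T i := by
    intro i
    rw [mem_smul_liuType_iff, ← mul_assoc, ← hc.comm g⁻¹, mul_assoc, (hT i).conj_mem_iff]
  simp only [mem_smul_liuType_iff, m]
  have hcast := congrArg (fun n : ℕ => (n : ℤ)) key
  simp only [Nat.cast_add, Nat.cast_ite, Nat.cast_one, Nat.cast_zero] at hcast
  linarith

/-- **The parity of the negative lines.**  At every embedding `g` an even number of the four corner lines
`(i₁, s), (i₂, s), (i₃, c s), (i₄, c s)` is negative (a line is negative at `g` iff `g` lies in the CM type of its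
character, Liu Def 4.12) — the parity identity behind the discriminant half of N1 (`T3FourthLine.lean`). -/
theorem even_card_negative_lines {c : G} (hc : IsComplexConj c) (T : ι → Finset G)
    (hT : ∀ i, IsCMType c (T i)) (h2 : SumTwo T) (h4 : Fintype.card ι = 4) {s : G} {i₁ i₂ i₃ i₄ : ι}
    (h12 : i₁ ≠ i₂) (hs₁ : s ∈ T i₁) (hs₂ : s ∈ T i₂) (h34 : i₃ ≠ i₄) (hs₃ : c * s ∈ T i₃) (hs₄ : c * s ∈ T i₄)
    (g : G) :
    Even ((if g ∈ s • liuType (T i₁) then 1 else 0) + (if g ∈ s • liuType (T i₂) then 1 else 0)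
        + (if g ∈ (c * s) • liuType (T i₃) then 1 else 0) + (if g ∈ (c * s) • liuType (T i₄) then 1 else 0) : ℕ) := by
  have h := forced_fourth_indicator hc T hT h2 h4 h12 hs₁ hs₂ h34 hs₃ hs₄ g
  refine ⟨(if g ∈ s • liuType (T i₁) then 1 else 0) + (if g ∈ s • liuType (T i₂) then 1 else 0), ?_⟩
  have hcast : (((if g ∈ s • liuType (T i₁) then 1 else 0) + (if g ∈ s • liuType (T i₂) then 1 else 0)
        + (if g ∈ (c * s) • liuType (T i₃) then 1 else 0) + (if g ∈ (c * s) • liuType (T i₄) then 1 else 0) : ℕ) : ℤ)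
      = ((if g ∈ s • liuType (T i₁) then 1 else 0) + (if g ∈ s • liuType (T i₂) then 1 else 0) : ℕ) + (((if g ∈ s • liuType (T i₁) then 1 else 0) + (if g ∈ s • liuType (T i₂) then 1 else 0) : ℕ) : ℤ) := by
    push_cast
    linarith
  exact_mod_cast hcast

/-! ### The conjugate-symplectic half (v2 append)

The forced fourth character `μ_{i₄,cs} := μ_{i₁,s} μ_{i₂,s} μ_{i₃,cs}⁻¹` must again be conjugate symplectic (Liu Def 4.1:
its restriction along the inclusion `ι : 𝔸_{F′}^× → 𝔸_{E′}^×` is the quadratic character `μ_{E′/F′}`).  Characters are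
abstract here: monoid homomorphisms from a commutative group to a commutative group, restricted along `ι`. -/

/-- If three characters `χ₁, χ₂, χ₃` of `B` restrict along `ι : A →* B` to the same character `η`, so does
`χ₁ χ₂ χ₃⁻¹` — the forced fourth corner character is again conjugate symplectic (TIER3.md §7, «N2 IS FREE»). -/
theorem comp_mul_mul_inv_eq {A B M : Type*} [MulOneClass A] [MulOneClass B] [CommGroup M] (ι : A →* B)
    {χ₁ χ₂ χ₃ : B →* M} {η : A →* M} (h₁ : χ₁.comp ι = η) (h₂ : χ₂.comp ι = η) (h₃ : χ₃.comp ι = η) :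
    (χ₁ * χ₂ * χ₃⁻¹).comp ι = η := by
  rw [MonoidHom.mul_comp, MonoidHom.mul_comp, MonoidHom.inv_comp, h₁, h₂, h₃, mul_inv_cancel_right]

end T3.ForcedFourth

end HodgeRepro
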